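import Summits.QuantumFields.BalabanUV.Beta.GAN24.OneStepConstraintAxialDelKVolumeLimit

/-!
# `BalabanUV.Beta.GAN24.OneStepConstraintAxialDelKVolumeEnds` — binder row G-an2-4 ∕ (CONV-C), routes C-R6° («VALUES») × R7 («TWO CURRENCIES») × pv09's B6 torus line × road P2's periodisation,
# PART 191: THE THREE ENDS OF THE GAUGE-FIXED ONE-LOOP STEP HAVE INFINITE-VOLUME LIMITS — `𝒮_n = effForm(re Δ_n, Q_ax)` (the gauge-fixed effective form), `ℋ_n = minOp(re Δ_n, Q_ax)` (the
# hard minimiser) and `𝒢_n = flucCov(re Δ_n, Q_ax)` READ AT FINE INTEGER BONDS `(ŵ, μ)`, `w ∈ ℤ^{d+1}` — every level `n ≥ 1`, every dimension `d + 1 ≥ 2`, every cubic coarse volume sequence,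
# NO RESIDUAL HYPOTHESIS; and the LIMIT KERNEL `𝒢_{n,∞}` on `ℤ^{d+1} × Fin (d+1)` NAMED.  Census V201″ (θ) and the packaging of PART 190 (unit b2b-balaban-gan24-p3, gen 61; v1)

NOT IN PRINT; OUR PROOF ([folklore] bookkeeping BY NAME over PART 188 `tendsto_inv_blockProp_eps`, PART 189 `tendsto_minOp_rho_eps`, PART 190 (`tendsto_reDelK_castT`,
`exists_tendsto_flucCov_DelK_axial`), PART 186 (`blocks_eq_of_ub`, `eps_injective`, `cpt_castT_add_off`), PART 185 `eventually_castT_eq_castT_iff`, PART 181 (`coercive_reg_DelK_axial_of_ub`,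
`abs_reDelK_le_par`, `form_le_of_entry_decay_par`, `not_corner_of_tree`), PART 180 `ub_QB_axial`, leaf-03 `exists_DelK_kernel_decay`, b05 `sum_exp_tdist_le`; [Balaban1984PropagatorsII]
(2.152)–(2.157) pp. 249–250 and [Balaban1987RG1] p. 264 (after (1.21)) LOCATE the objects and the `T ↗ ℤ^d` limit; nothing printed is a hypothesis).
HONEST FRAMING (cell contract, verbatim): «discharging `BetaPertH` makes Bałaban's UV stability UNCONDITIONAL — a real constructive-QFT result; it is NOT the
continuum limit and NOT the Clay problem.»  HONEST DEPENDENCY (verbatim): «continuum YM on T⁴ ⇐ BetaPertH ∧ nine spine estimates (0/9 proved); BetaPertH ⇐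
(D1) ∧ (D4) ∧ CAP+tail; G-an2-4 gates asym, D1 and NE2/3/4.»

WHAT THIS FILE PROVES (0 sorry, 0 `def`; `d + 1 ≥ 2`, every `Lb ≥ 1`, all `a, a′ > 0`, every `n ≥ 1`, every cubic coarse volume sequence `s t → ∞`; `M_t = cubic (d+1) (s t)`,
`Q_ax,t = fromRows (re QB 1 Lb M_t) E_tree`, readings `ẑ = castT (fine 1 M_t) z` (block), `ŵ = castT (fine (Lb·1) M_t) w` (fine), `ρ`, `ε` of PART 186):
* **`exists_tendsto_effForm_DelK_axial`** — `∀ g g′ z z′, ∃ c, 𝒮_{n,t}(ε(ẑ,g), ε(ẑ′,g′)) → c` (`𝒮 = P⁻¹ − a′•1`, PART 188's EL₂ of `P⁻¹`; the unit matrix at stacked readings is eventually constant).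
* **`exists_tendsto_minOp_DelK_axial`** — `∀ f g z z′, ∃ c, ℋ_{n,t}(ρ(ẑ,f), ε(ẑ′,g)) → c` (PART 189).
* `castT_fine_eq_rho` (a fine integer bond `ŵ` IS the block-fibred reading `ρ(ẑ,(j,μ))` with `z = ⌊w∕Lb⌋`, `j = w mod Lb`), **`exists_tendsto_flucCov_DelK_axial_castT`** —
  `∀ w μ w′ μ′, ∃ c, 𝒢_{n,t}((ŵ,μ),(ŵ′,μ′)) → c` (PART 190 at fine integer bonds), **`exists_flucCov_DelK_axial_limitKernel`** — `∃ 𝒢_∞ : (ℤ^{d+1} × Fin (d+1)) → (ℤ^{d+1} × Fin (d+1)) → ℝ`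
  with `𝒢_{n,t}((ŵ,μ),(ŵ′,μ′)) → 𝒢_∞ (w,μ) (w′,μ′)` for all fine integer bonds (the limit NAMED).
WHAT IT IS NOT: the decay ∕ the (SR) rate of the limit kernel (they follow from PARTs 181 ∕ 183 by `le_of_tendsto` once `tdist` at integer readings is identified with the `ℤ^{d+1}`
distance — follower), the loop contraction (ζ).  SUPPLIER work; NEVER «G-an2-4 closed»; NOT (CONV-C), NOT D1, NOT `BetaPertH`, NOT continuum, NOT Clay.  Records: `HOME/b2b-balaban-gan24-p3/gen61/README.md`.
-/

noncomputable section

open scoped BigOperators ComplexConjugate Matrix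
open Filter Topology Finset Matrix

namespace Summit.QuantumFields.BalabanUV.Beta.GAN24.OneStepConstraintAxialDelKVolumeEnds

open Literature.MathematicalPhysics.QuantumFieldTheory.Balaban1983to89
open Literature.MathematicalPhysics.QuantumFieldTheory.Balaban1983to89.B5Prop11Plancherel (Tor fine)
open Literature.MathematicalPhysics.QuantumFieldTheory.Balaban1983to89.B5RealFields (reM reM_apply)
open Literature.MathematicalPhysics.QuantumFieldTheory.Balaban1983to89.B5G183RateTorus (cpt)
open Literature.MathematicalPhysics.QuantumFieldTheory.Balaban1983to89.B5G183RateTorusW (off)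
open Literature.MathematicalPhysics.QuantumFieldTheory.Balaban1983to89.Beta.FreeLegDictionary (cubic)
open Literature.MathematicalPhysics.QuantumFieldTheory.Balaban1983to89.Beta.VectorTails (castT)
open Literature.MathematicalPhysics.QuantumFieldTheory.Balaban1983to89.Beta.VectorTailsCov (tdist sum_exp_tdist_le)
open Literature.MathematicalPhysics.QuantumFieldTheory.Balaban1983to89.Beta.Composition (blockProp)
open Literature.MathematicalPhysics.QuantumFieldTheory.Balaban1983to89.Beta.CompositionSingular (effForm minOp flucCov)
open Literature.MathematicalPhysics.QuantumFieldTheory.Balaban1983to89.Beta.BlockEffectiveAction (DelK)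
open Literature.MathematicalPhysics.QuantumFieldTheory.Balaban1983to89.B6Cov2156TorusDelK (gamma2153one gamma2153one_pos)
open Summit.QuantumFields.BalabanUV.T4Continuum.BalabanLineAverage (QB)
open Summit.QuantumFields.BalabanUV.T4Continuum.BalabanAveragedTowerModes (par rem)
open Summit.QuantumFields.BalabanUV.Beta.GAN24.EffectiveFormLocalisation (transpose_reg)
open Summit.QuantumFields.BalabanUV.Beta.GAN24.AveragedPropagatorInverseUniform (exists_DelK_kernel_decay)
open Summit.QuantumFields.BalabanUV.Beta.GAN24.OneStepConstraintAxialCoercivity (reDelK_transpose dotProduct_reDelK_nonneg)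
open Summit.QuantumFields.BalabanUV.Beta.GAN24.OneStepConstraintBlockGeometry (form_le_of_entry_decay_par not_corner_of_tree)
open Summit.QuantumFields.BalabanUV.Beta.GAN24.OneStepConstraintAxialLocalisation (ub_QB_axial)
open Summit.QuantumFields.BalabanUV.Beta.GAN24.OneStepConstraintAxialDelK (coercive_reg_DelK_axial_of_ub abs_reDelK_le_par)
open Summit.QuantumFields.BalabanUV.Beta.GAN24.VolumeLimitPairsRect (eventually_castT_eq_castT_iff)
open Summit.QuantumFields.BalabanUV.Beta.GAN24.OneStepConstraintBlockPresentation (tree_cpt_add_off cpt_castT_add_off eps_injective blocks_eq_of_ub)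
open Summit.QuantumFields.BalabanUV.Beta.GAN24.OneStepConstraintAxialVolumeProp (tendsto_inv_blockProp_eps)
open Summit.QuantumFields.BalabanUV.Beta.GAN24.OneStepConstraintAxialVolumeLimit (tendsto_minOp_rho_eps)
open Summit.QuantumFields.BalabanUV.Beta.GAN24.OneStepConstraintAxialDelKVolumeLimit (tendsto_reDelK_castT exists_tendsto_flucCov_DelK_axial)

variable {d : ℕ}

/-- a fine integer bond IS a block-fibred reading: `ŵ = cpt ẑ + off j` with `z_ν = ⌊w_ν∕Lb⌋`, `j_ν = w_ν mod Lb` (PART 186 `cpt_castT_add_off` and `w = Lb·⌊w∕Lb⌋ + w mod Lb`). [folklore] -/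
theorem castT_fine_eq_rho (Lb : ℕ) [NeZero Lb] (M₁ : Fin (d + 1) → ℕ) [∀ μ, NeZero (M₁ μ)] (w : Fin (d + 1) → ℤ) :
    castT (fine (Lb * 1) M₁) w = cpt 1 Lb M₁ (castT (fine 1 M₁) (fun ν => w ν / (Lb : ℤ))) +
      off 1 Lb M₁ (fun ν => (⟨(w ν % (Lb : ℤ)).toNat, by
        have hL : (0 : ℤ) < Lb := by exact_mod_cast Nat.pos_of_ne_zero (NeZero.ne Lb)
        have h1 := Int.emod_lt_of_pos (w ν) hL
        have h0 := Int.emod_nonneg (w ν) hL.ne'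
        omega⟩ : Fin Lb)) := by
  rw [cpt_castT_add_off]
  congr 1
  funext ν
  have hL : (0 : ℤ) < Lb := by exact_mod_cast Nat.pos_of_ne_zero (NeZero.ne Lb)
  have h0 := Int.emod_nonneg (w ν) hL.ne'
  rw [Int.toNat_of_nonneg h0, Int.emod_def]
  ring

variable (Lb : ℕ) [NeZero Lb] (n : ℕ) [NeZero n] (hn : 1 ≤ n) (a : ℝ) (ha : 0 < a) (s : ℕ → ℕ) [hs0 : ∀ t, NeZero (s t)]

/-! ## §1 The gauge-fixed effective form `𝒮_n = P⁻¹ − a′•1` at stacked readings -/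

/-- **`exists_tendsto_effForm_DelK_axial` — EL₂ OF THE GAUGE-FIXED EFFECTIVE FORM OF THE ONE-LOOP STEP, NO RESIDUAL HYPOTHESIS** (census V201″ (θ)): in dimension `d + 1 ≥ 2`, for every
`Lb ≥ 1`, all `a, a′ > 0`, every `n ≥ 1` and every cubic coarse volume sequence `s t → ∞`, the entries of `𝒮_n = effForm (re Δ_n) Q_ax,t` at stacked readings `ε(ẑ,g)`, `ε(ẑ′,g′)` converge
(`𝒮 = P⁻¹ − a′•1` by PART 186 `blocks_eq_of_ub`; EL₂ of `P⁻¹` by PART 188 with every letter discharged as in PART 190; the unit matrix at stacked readings is eventually `[(z,g) = (z′,g′)]`). [folklore] -/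
theorem exists_tendsto_effForm_DelK_axial (hd : 1 ≤ d) (hs : Tendsto s atTop atTop) {a' : ℝ} (ha' : 0 < a')
    (g g' : Fin (d + 1) ⊕ {f : (Fin (d + 1) → Fin Lb) × Fin (d + 1) // (∀ ν, ν < f.2 → ((f.1 ν : ℕ)) = 0) ∧ ((f.1 f.2 : ℕ)) + 1 < Lb}) (z z' : Fin (d + 1) → ℤ) :
    ∃ c : ℝ, Tendsto (fun t => effForm (reM (DelK n hn (fine (Lb * 1) (cubic (d + 1) (s t))) a ha)) (Matrix.fromRows (reM (QB 1 Lb (cubic (d + 1) (s t)))) (fun (t' : {x : Tor (fine (Lb * 1) (cubic (d + 1) (s t))) × Fin (d + 1) // (∀ ν, ν < x.2 → ((rem 1 Lb (cubic (d + 1) (s t)) x.1 ν : ℕ)) = 0) ∧ ((rem 1 Lb (cubic (d + 1) (s t)) x.1 x.2 : ℕ)) + 1 < Lb}) (x : Tor (fine (Lb * 1) (cubic (d + 1) (s t))) × Fin (d + 1)) => if x = (Function.Embedding.subtype (fun x : Tor (fine (Lb * 1) (cubic (d + 1) (s t))) × Fin (d + 1) => (∀ ν, ν < x.2 → ((rem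 1 Lb (cubic (d + 1) (s t)) x.1 ν : ℕ)) = 0) ∧ ((rem 1 Lb (cubic (d + 1) (s t)) x.1 x.2 : ℕ)) + 1 < Lb)) t' then (1 : ℝ) else 0)) (Sum.elim (fun μ : Fin (d + 1) => (Sum.inl ((castT (fine 1 (cubic (d + 1) (s t))) z), μ) : ((Tor (fine 1 (cubic (d + 1) (s t))) × Fin (d + 1)) ⊕ {x : Tor (fine (Lb * 1) (cubic (d + 1) (s t))) × Fin (d + 1) // (∀ ν, ν < x.2 → ((rem 1 Lb (cubic (d + 1) (s t)) x.1 ν : ℕ)) = 0) ∧ ((rem 1 Lb (cubic (d + 1) (s t)) x.1 x.2 : ℕ)) + 1 < Lb}))) (fun f : {f : (Fin (d + 1) → Fin Lb) × Fin (d + 1) // (∀ ν, ν < f.2 → ((f.1 ν : ℕ)) = 0) ∧ ((f.1 f.2 : ℕ)) + 1 < Lb} => Sum.inr ⟨(cpt 1 Lb (cubic (d + 1) (s t)) ((castT (fine 1 (cubic (d + 1) (s t))) z)) + off 1 Lb (cubic (d + 1) (s t)) f.1.1, f.1.2), tree_cpt_add_off 1 Lb (cubic (d + 1) (s t)) _ f⟩)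 (g)) (Sum.elim (fun μ : Fin (d + 1) => (Sum.inl ((castT (fine 1 (cubic (d + 1) (s t))) z'), μ) : ((Tor (fine 1 (cubic (d + 1) (s t))) × Fin (d + 1)) ⊕ {x : Tor (fine (Lb * 1) (cubic (d + 1) (s t))) × Fin (d + 1) // (∀ ν, ν < x.2 → ((rem 1 Lb (cubic (d + 1) (s t)) x.1 ν : ℕ)) = 0) ∧ ((rem 1 Lb (cubic (d + 1) (s t)) x.1 x.2 : ℕ)) + 1 < Lb}))) (fun f : {f : (Fin (d + 1) → Fin Lb) × Fin (d + 1) // (∀ ν, ν < f.2 → ((f.1 ν : ℕ)) = 0) ∧ ((f.1 f.2 : ℕ)) + 1 < Lb} => Sum.inr ⟨(cpt 1 Lb (cubic (d + 1) (s t)) ((castT (fine 1 (cubic (d + 1) (s t))) z')) + off 1 Lb (cubic (d + 1) (s t)) f.1.1, f.1.2), tree_cpt_add_off 1 Lb (cubic (d + 1) (s t)) _ f⟩) (g'))) atTop (𝓝 c) := by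
  classical
  have hd' : 1 ≤ d + 1 := by omega
  have hd2 : 2 ≤ d + 1 := by omega
  have hLb : (1 : ℝ) ≤ Lb := by exact_mod_cast Nat.one_le_iff_ne_zero.2 (NeZero.ne Lb)
  obtain ⟨c₀, δ₀, hc₀, hδ₀, hker⟩ := exists_DelK_kernel_decay (d := d)
  have hex : ∀ s' : ℝ, ∃ S : ℝ, 0 ≤ S ∧ (0 < s' → ∀ (N : Fin (d + 1) → ℕ) [∀ μ, NeZero (N μ)] (y : (μ : Fin (d + 1)) → ZMod (N μ)),
      ∑ y', Real.exp (-(s' * (tdist y y' : ℝ))) ≤ S) := by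
    intro s'
    by_cases hs' : 0 < s'
    · obtain ⟨S, hS0, hS⟩ := sum_exp_tdist_le (d := d + 1) hd2 hs'
      exact ⟨S, hS0, fun _ => hS⟩
    · exact ⟨0, le_rfl, fun h => absurd h hs'⟩
  choose Kf hKf0' hKf' using hex
  have hKf0 : ∀ s' : ℝ, 0 < s' → 0 ≤ Kf s' := fun s' _ => hKf0' s'
  have hh₀0 : 0 ≤ c₀ * Real.exp (δ₀ * ((Lb : ℝ) - 1)) := by positivity
  have hδH0 : 0 < δ₀ * Lb := by positivity
  have hγ₀ : 0 < gamma2153one (d + 1) (Lb * 1) := gamma2153one_pos (by omega) (Nat.one_le_iff_ne_zero.2 (NeZero.ne (Lb * 1)))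
  have hHent : ∀ t (x x' : Tor (fine (Lb * 1) (cubic (d + 1) (s t))) × Fin (d + 1)), |reM (DelK n hn (fine (Lb * 1) (cubic (d + 1) (s t))) a ha) x x'| ≤
      c₀ * Real.exp (δ₀ * ((Lb : ℝ) - 1)) * Real.exp (-(δ₀ * Lb * (tdist (par 1 Lb (cubic (d + 1) (s t)) x.1) (par 1 Lb (cubic (d + 1) (s t)) x'.1) : ℝ))) :=
    fun t x x' => abs_reDelK_le_par Lb n hn a ha (cubic (d + 1) (s t)) hc₀.le hδ₀.le (fun q' q => hker n hn (fine (Lb * 1) (cubic (d + 1) (s t))) a ha q' q) x x'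
  have hh0 : 0 ≤ c₀ * Real.exp (δ₀ * ((Lb : ℝ) - 1)) * ((((d + 1 : ℕ) : ℝ)) * (Lb : ℝ) ^ (d + 1) * Kf (δ₀ * Lb)) := by have := hKf0' (δ₀ * Lb); positivity
  have hHub : ∀ t (u : Tor (fine (Lb * 1) (cubic (d + 1) (s t))) × Fin (d + 1) → ℝ), u ⬝ᵥ (reM (DelK n hn (fine (Lb * 1) (cubic (d + 1) (s t))) a ha) *ᵥ u) ≤
      c₀ * Real.exp (δ₀ * ((Lb : ℝ) - 1)) * ((((d + 1 : ℕ) : ℝ)) * (Lb : ℝ) ^ (d + 1) * Kf (δ₀ * Lb)) * (u ⬝ᵥ u) :=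
    fun t u => form_le_of_entry_decay_par 1 Lb (cubic (d + 1) (s t)) (reDelK_transpose Lb (cubic (d + 1) (s t)) n hn a ha) (fun s' hs' y => hKf' s' hs' _ y) hh₀0 hδH0 (hHent t) u
  have hMv : ∀ Nb : ℕ, ∀ᶠ t in atTop, ∀ i : Fin (d + 1), Nb ≤ fine (Lb * 1) (cubic (d + 1) (s t)) i := by
    intro Nb
    filter_upwards [hs.eventually_ge_atTop Nb] with t ht i
    exact ht.trans (Nat.le_mul_of_pos_left _ (Nat.pos_of_ne_zero (NeZero.ne (Lb * 1))))
  have hHlim : ∀ (f₁ f₁' : (Fin (d + 1) → Fin Lb) × Fin (d + 1)) (u u' : Fin (d + 1) → ℤ), ∃ c : ℝ, Tendsto (fun t => reM (DelK n hn (fine (Lb * 1) (cubic (d + 1) (s t))) a ha)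
      ((cpt 1 Lb (cubic (d + 1) (s t)) (castT (fine 1 (cubic (d + 1) (s t))) u) + off 1 Lb (cubic (d + 1) (s t)) f₁.1, f₁.2) : Tor (fine (Lb * 1) (cubic (d + 1) (s t))) × Fin (d + 1))
      ((cpt 1 Lb (cubic (d + 1) (s t)) (castT (fine 1 (cubic (d + 1) (s t))) u') + off 1 Lb (cubic (d + 1) (s t)) f₁'.1, f₁'.2) : Tor (fine (Lb * 1) (cubic (d + 1) (s t))) × Fin (d + 1))) atTop (𝓝 c) := by
    intro f₁ f₁' u u'
    refine ⟨_, (tendsto_reDelK_castT (fun t => fine (Lb * 1) (cubic (d + 1) (s t))) hMv n hn a ha f₁.2 f₁'.2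
      (fun ν => (Lb : ℤ) * u ν + ((f₁.1 ν : ℕ) : ℤ)) (fun ν => (Lb : ℤ) * u' ν + ((f₁'.1 ν : ℕ) : ℤ))).congr fun t => ?_⟩
    rw [cpt_castT_add_off, cpt_castT_add_off]
  have hh : 0 ≤ c₀ * Real.exp (δ₀ * ((Lb : ℝ) - 1)) * ((((d + 1 : ℕ) : ℝ)) * (Lb : ℝ) ^ (d + 1) * Kf (δ₀ * Lb)) := hh0
  have hΛ0 : 0 ≤ c₀ * Real.exp (δ₀ * ((Lb : ℝ) - 1)) * ((((d + 1 : ℕ) : ℝ)) * (Lb : ℝ) ^ (d + 1) * Kf (δ₀ * Lb)) * (4 * ((Lb : ℝ) ^ (d + 1)) ^ 2 * (1 + ((Lb : ℝ) ^ (d + 1))⁻¹) + 2 * 1) := by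
    positivity
  have hblocks := fun t => blocks_eq_of_ub (reDelK_transpose Lb (cubic (d + 1) (s t)) n hn a ha) (dotProduct_reDelK_nonneg Lb (cubic (d + 1) (s t)) n hn a ha) ha'
    (inv_pos.mpr (lt_of_lt_of_le (div_pos four_pos hγ₀) (le_max_left _ _))) (coercive_reg_DelK_axial_of_ub Lb (cubic (d + 1) (s t)) n hn a ha hd2 hh0 (hHub t) ha') hΛ0
    (ub_QB_axial 1 Lb (cubic (d + 1) (s t)) _ (not_corner_of_tree 1 Lb (cubic (d + 1) (s t))) hh (hHub t))
  obtain ⟨c, hc⟩ := tendsto_inv_blockProp_eps 1 Lb s hd' hs hKf0 (fun s' hs' t y => hKf' s' hs' _ y) (fun t => reDelK_transpose Lb (cubic (d + 1) (s t)) n hn a ha)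
    (fun t => dotProduct_reDelK_nonneg Lb (cubic (d + 1) (s t)) n hn a ha) ha' hh₀0 hδH0
    (inv_pos.mpr (lt_of_lt_of_le (div_pos four_pos hγ₀) (le_max_left _ _))) hHent
    (fun t => coercive_reg_DelK_axial_of_ub Lb (cubic (d + 1) (s t)) n hn a ha hd2 hh0 (hHub t) ha') hHlim g g' z z'
  have hN : 1 ≤ (1 : ℕ) := le_rfl
  have hone : Tendsto (fun t => (a' • (1 : Matrix ((Tor (fine 1 (cubic (d + 1) (s t))) × Fin (d + 1)) ⊕ {x : Tor (fine (Lb * 1) (cubic (d + 1) (s t))) × Fin (d + 1) // (∀ ν, ν < x.2 → ((rem 1 Lb (cubic (d + 1) (s t)) x.1 ν : ℕ)) = 0) ∧ ((rem 1 Lb (cubic (d + 1) (s t)) x.1 x.2 : ℕ)) + 1 < Lb}) ((Tor (fine 1 (cubic (d + 1) (s t))) × Fin (d + 1)) ⊕ {x : Tor (fine (Lb * 1) (cubic (d + 1) (s t))) × Fin (d + 1) // (∀ ν, ν < x.2 → ((rem 1 Lb (cubic (d + 1) (s t)) x.1 ν : ℕ)) = 0) ∧ ((rem 1 Lb (cubic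 (d + 1) (s t)) x.1 x.2 : ℕ)) + 1 < Lb}) ℝ)) (Sum.elim (fun μ : Fin (d + 1) => (Sum.inl ((castT (fine 1 (cubic (d + 1) (s t))) z), μ) : ((Tor (fine 1 (cubic (d + 1) (s t))) × Fin (d + 1)) ⊕ {x : Tor (fine (Lb * 1) (cubic (d + 1) (s t))) × Fin (d + 1) // (∀ ν, ν < x.2 → ((rem 1 Lb (cubic (d + 1) (s t)) x.1 ν : ℕ)) = 0) ∧ ((rem 1 Lb (cubic (d + 1) (s t)) x.1 x.2 : ℕ)) + 1 < Lb}))) (fun f : {f : (Fin (d + 1) → Fin Lb) × Fin (d + 1) // (∀ ν, ν < f.2 → ((f.1 ν : ℕ)) = 0) ∧ ((f.1 f.2 : ℕ)) + 1 < Lb} => Sum.inr ⟨(cpt 1 Lb (cubic (d + 1) (s t)) ((castT (fine 1 (cubic (d + 1) (s t))) z)) + off 1 Lb (cubic (d + 1) (s t)) f.1.1, f.1.2), tree_cpt_add_off 1 Lb (cubic (d + 1) (s t)) _ f⟩) (g)) (Sum.elim (fun μ : Fin (d + 1) => (Sum.inl ((castT (fine 1 (cubic (d + 1) (s t))) z'),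 μ) : ((Tor (fine 1 (cubic (d + 1) (s t))) × Fin (d + 1)) ⊕ {x : Tor (fine (Lb * 1) (cubic (d + 1) (s t))) × Fin (d + 1) // (∀ ν, ν < x.2 → ((rem 1 Lb (cubic (d + 1) (s t)) x.1 ν : ℕ)) = 0) ∧ ((rem 1 Lb (cubic (d + 1) (s t)) x.1 x.2 : ℕ)) + 1 < Lb}))) (fun f : {f : (Fin (d + 1) → Fin Lb) × Fin (d + 1) // (∀ ν, ν < f.2 → ((f.1 ν : ℕ)) = 0) ∧ ((f.1 f.2 : ℕ)) + 1 < Lb} => Sum.inr ⟨(cpt 1 Lb (cubic (d + 1) (s t)) ((castT (fine 1 (cubic (d + 1) (s t))) z')) + off 1 Lb (cubic (d + 1) (s t)) f.1.1, f.1.2), tree_cpt_add_off 1 Lb (cubic (d + 1) (s t)) _ f⟩) (g'))) atTop (𝓝 (if (z = z' ∧ g = g') then a' else 0)) := by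
    refine tendsto_const_nhds.congr' ?_
    filter_upwards [eventually_castT_eq_castT_iff hs 1 hN z z'] with t ht
    have hiff : ((Sum.elim (fun μ : Fin (d + 1) => (Sum.inl ((castT (fine 1 (cubic (d + 1) (s t))) z), μ) : ((Tor (fine 1 (cubic (d + 1) (s t))) × Fin (d + 1)) ⊕ {x : Tor (fine (Lb * 1) (cubic (d + 1) (s t))) × Fin (d + 1) // (∀ ν, ν < x.2 → ((rem 1 Lb (cubic (d + 1) (s t)) x.1 ν : ℕ)) = 0) ∧ ((rem 1 Lb (cubic (d + 1) (s t)) x.1 x.2 : ℕ)) + 1 < Lb}))) (fun f : {f : (Fin (d + 1) → Fin Lb) × Fin (d + 1) // (∀ ν, ν < f.2 → ((f.1 ν : ℕ)) = 0) ∧ ((f.1 f.2 : ℕ)) + 1 < Lb} => Sum.inr ⟨(cpt 1 Lb (cubic (d + 1) (s t)) ((castT (fine 1 (cubic (d + 1) (s t))) z)) + off 1 Lb (cubic (d + 1) (s t)) f.1.1, f.1.2), tree_cpt_add_off 1 Lb (cubic (d + 1) (s t)) _ f⟩) (g)) = (Sum.elim (fun μ : Fin (d + 1) => (Sum.inl ((castT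 (fine 1 (cubic (d + 1) (s t))) z'), μ) : ((Tor (fine 1 (cubic (d + 1) (s t))) × Fin (d + 1)) ⊕ {x : Tor (fine (Lb * 1) (cubic (d + 1) (s t))) × Fin (d + 1) // (∀ ν, ν < x.2 → ((rem 1 Lb (cubic (d + 1) (s t)) x.1 ν : ℕ)) = 0) ∧ ((rem 1 Lb (cubic (d + 1) (s t)) x.1 x.2 : ℕ)) + 1 < Lb}))) (fun f : {f : (Fin (d + 1) → Fin Lb) × Fin (d + 1) // (∀ ν, ν < f.2 → ((f.1 ν : ℕ)) = 0) ∧ ((f.1 f.2 : ℕ)) + 1 < Lb} => Sum.inr ⟨(cpt 1 Lb (cubic (d + 1) (s t)) ((castT (fine 1 (cubic (d + 1) (s t))) z')) + off 1 Lb (cubic (d + 1) (s t)) f.1.1, f.1.2), tree_cpt_add_off 1 Lb (cubic (d + 1) (s t)) _ f⟩) (g'))) ↔ (z = z' ∧ g = g') := by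
      constructor
      · intro h
        have h' := eps_injective 1 Lb (cubic (d + 1) (s t)) (a₁ := (castT (fine 1 (cubic (d + 1) (s t))) z, g)) (a₂ := (castT (fine 1 (cubic (d + 1) (s t))) z', g')) h
        rw [Prod.mk.injEq] at h'
        exact ⟨ht.mp h'.1, h'.2⟩
      · rintro ⟨rfl, rfl⟩; rfl
    rw [Matrix.smul_apply, Matrix.one_apply, smul_eq_mul, mul_ite, mul_one a', mul_zero a']
    exact (if_congr hiff rfl rfl).symm
  refine ⟨c - (if (z = z' ∧ g = g') then a' else 0), (hc.sub hone).congr fun t => ?_⟩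
  rw [(hblocks t).1, Matrix.sub_apply]

/-! ## §2 The hard minimiser `ℋ_n` at (fine, stacked) readings -/

/-- **`exists_tendsto_minOp_DelK_axial` — EL₂ OF THE HARD MINIMISER OF THE ONE-LOOP STEP, NO RESIDUAL HYPOTHESIS** (census V201″ (θ)): the entries of `ℋ_n = minOp (re Δ_n) Q_ax,t` at readings
`ρ(ẑ,f)`, `ε(ẑ′,g)` converge along every cubic coarse volume sequence (PART 189 `tendsto_minOp_rho_eps`, letters as in PART 190). [folklore] -/
theorem exists_tendsto_minOp_DelK_axial (hd : 1 ≤ d) (hs : Tendsto s atTop atTop) {a' : ℝ} (ha' : 0 < a')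
    (f : (Fin (d + 1) → Fin Lb) × Fin (d + 1)) (g : Fin (d + 1) ⊕ {f : (Fin (d + 1) → Fin Lb) × Fin (d + 1) // (∀ ν, ν < f.2 → ((f.1 ν : ℕ)) = 0) ∧ ((f.1 f.2 : ℕ)) + 1 < Lb}) (z z' : Fin (d + 1) → ℤ) :
    ∃ c : ℝ, Tendsto (fun t => minOp (reM (DelK n hn (fine (Lb * 1) (cubic (d + 1) (s t))) a ha)) (Matrix.fromRows (reM (QB 1 Lb (cubic (d + 1) (s t)))) (fun (t' : {x : Tor (fine (Lb * 1) (cubic (d + 1) (s t))) × Fin (d + 1) // (∀ ν, ν < x.2 → ((rem 1 Lb (cubic (d + 1) (s t)) x.1 ν : ℕ)) = 0) ∧ ((rem 1 Lb (cubic (d + 1) (s t)) x.1 x.2 : ℕ)) + 1 < Lb}) (x : Tor (fine (Lb * 1) (cubic (d + 1) (s t))) × Fin (d + 1)) => if x = (Function.Embedding.subtype (fun x : Tor (fine (Lb * 1) (cubic (d + 1) (s t))) × Fin (d + 1) => (∀ ν, ν < x.2 → ((rem 1 Lb (cubic (d + 1) (s t)) x.1 ν : ℕ)) = 0) ∧ ((rem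 1 Lb (cubic (d + 1) (s t)) x.1 x.2 : ℕ)) + 1 < Lb)) t' then (1 : ℝ) else 0)) ((cpt 1 Lb (cubic (d + 1) (s t)) ((castT (fine 1 (cubic (d + 1) (s t))) z)) + off 1 Lb (cubic (d + 1) (s t)) (f).1, (f).2) : Tor (fine (Lb * 1) (cubic (d + 1) (s t))) × Fin (d + 1)) (Sum.elim (fun μ : Fin (d + 1) => (Sum.inl ((castT (fine 1 (cubic (d + 1) (s t))) z'), μ) : ((Tor (fine 1 (cubic (d + 1) (s t))) × Fin (d + 1)) ⊕ {x : Tor (fine (Lb * 1) (cubic (d + 1) (s t))) × Fin (d + 1) // (∀ ν, ν < x.2 → ((rem 1 Lb (cubic (d + 1) (s t)) x.1 ν : ℕ)) = 0) ∧ ((rem 1 Lb (cubic (d + 1) (s t)) x.1 x.2 : ℕ)) + 1 < Lb}))) (fun f : {f : (Fin (d + 1) → Fin Lb) × Fin (d + 1) // (∀ ν, ν < f.2 → ((f.1 ν : ℕ)) = 0) ∧ ((f.1 f.2 : ℕ)) + 1 < Lb} => Sum.inr ⟨(cpt 1 Lb (cubic (d + 1) (s t)) ((castT (fine 1 (cubic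 (d + 1) (s t))) z')) + off 1 Lb (cubic (d + 1) (s t)) f.1.1, f.1.2), tree_cpt_add_off 1 Lb (cubic (d + 1) (s t)) _ f⟩) (g))) atTop (𝓝 c) := by
  classical
  have hd' : 1 ≤ d + 1 := by omega
  have hd2 : 2 ≤ d + 1 := by omega
  have hLb : (1 : ℝ) ≤ Lb := by exact_mod_cast Nat.one_le_iff_ne_zero.2 (NeZero.ne Lb)
  obtain ⟨c₀, δ₀, hc₀, hδ₀, hker⟩ := exists_DelK_kernel_decay (d := d)
  have hex : ∀ s' : ℝ, ∃ S : ℝ, 0 ≤ S ∧ (0 < s' → ∀ (N : Fin (d + 1) → ℕ) [∀ μ, NeZero (N μ)] (y : (μ : Fin (d + 1)) → ZMod (N μ)),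
      ∑ y', Real.exp (-(s' * (tdist y y' : ℝ))) ≤ S) := by
    intro s'
    by_cases hs' : 0 < s'
    · obtain ⟨S, hS0, hS⟩ := sum_exp_tdist_le (d := d + 1) hd2 hs'
      exact ⟨S, hS0, fun _ => hS⟩
    · exact ⟨0, le_rfl, fun h => absurd h hs'⟩
  choose Kf hKf0' hKf' using hex
  have hKf0 : ∀ s' : ℝ, 0 < s' → 0 ≤ Kf s' := fun s' _ => hKf0' s'
  have hh₀0 : 0 ≤ c₀ * Real.exp (δ₀ * ((Lb : ℝ) - 1)) := by positivity
  have hδH0 : 0 < δ₀ * Lb := by positivity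
  have hγ₀ : 0 < gamma2153one (d + 1) (Lb * 1) := gamma2153one_pos (by omega) (Nat.one_le_iff_ne_zero.2 (NeZero.ne (Lb * 1)))
  have hHent : ∀ t (x x' : Tor (fine (Lb * 1) (cubic (d + 1) (s t))) × Fin (d + 1)), |reM (DelK n hn (fine (Lb * 1) (cubic (d + 1) (s t))) a ha) x x'| ≤
      c₀ * Real.exp (δ₀ * ((Lb : ℝ) - 1)) * Real.exp (-(δ₀ * Lb * (tdist (par 1 Lb (cubic (d + 1) (s t)) x.1) (par 1 Lb (cubic (d + 1) (s t)) x'.1) : ℝ))) :=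
    fun t x x' => abs_reDelK_le_par Lb n hn a ha (cubic (d + 1) (s t)) hc₀.le hδ₀.le (fun q' q => hker n hn (fine (Lb * 1) (cubic (d + 1) (s t))) a ha q' q) x x'
  have hh0 : 0 ≤ c₀ * Real.exp (δ₀ * ((Lb : ℝ) - 1)) * ((((d + 1 : ℕ) : ℝ)) * (Lb : ℝ) ^ (d + 1) * Kf (δ₀ * Lb)) := by have := hKf0' (δ₀ * Lb); positivity
  have hHub : ∀ t (u : Tor (fine (Lb * 1) (cubic (d + 1) (s t))) × Fin (d + 1) → ℝ), u ⬝ᵥ (reM (DelK n hn (fine (Lb * 1) (cubic (d + 1) (s t))) a ha) *ᵥ u) ≤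
      c₀ * Real.exp (δ₀ * ((Lb : ℝ) - 1)) * ((((d + 1 : ℕ) : ℝ)) * (Lb : ℝ) ^ (d + 1) * Kf (δ₀ * Lb)) * (u ⬝ᵥ u) :=
    fun t u => form_le_of_entry_decay_par 1 Lb (cubic (d + 1) (s t)) (reDelK_transpose Lb (cubic (d + 1) (s t)) n hn a ha) (fun s' hs' y => hKf' s' hs' _ y) hh₀0 hδH0 (hHent t) u
  have hMv : ∀ Nb : ℕ, ∀ᶠ t in atTop, ∀ i : Fin (d + 1), Nb ≤ fine (Lb * 1) (cubic (d + 1) (s t)) i := by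
    intro Nb
    filter_upwards [hs.eventually_ge_atTop Nb] with t ht i
    exact ht.trans (Nat.le_mul_of_pos_left _ (Nat.pos_of_ne_zero (NeZero.ne (Lb * 1))))
  have hHlim : ∀ (f₁ f₁' : (Fin (d + 1) → Fin Lb) × Fin (d + 1)) (u u' : Fin (d + 1) → ℤ), ∃ c : ℝ, Tendsto (fun t => reM (DelK n hn (fine (Lb * 1) (cubic (d + 1) (s t))) a ha)
      ((cpt 1 Lb (cubic (d + 1) (s t)) (castT (fine 1 (cubic (d + 1) (s t))) u) + off 1 Lb (cubic (d + 1) (s t)) f₁.1, f₁.2) : Tor (fine (Lb * 1) (cubic (d + 1) (s t))) × Fin (d + 1))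
      ((cpt 1 Lb (cubic (d + 1) (s t)) (castT (fine 1 (cubic (d + 1) (s t))) u') + off 1 Lb (cubic (d + 1) (s t)) f₁'.1, f₁'.2) : Tor (fine (Lb * 1) (cubic (d + 1) (s t))) × Fin (d + 1))) atTop (𝓝 c) := by
    intro f₁ f₁' u u'
    refine ⟨_, (tendsto_reDelK_castT (fun t => fine (Lb * 1) (cubic (d + 1) (s t))) hMv n hn a ha f₁.2 f₁'.2
      (fun ν => (Lb : ℤ) * u ν + ((f₁.1 ν : ℕ) : ℤ)) (fun ν => (Lb : ℤ) * u' ν + ((f₁'.1 ν : ℕ) : ℤ))).congr fun t => ?_⟩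
    rw [cpt_castT_add_off, cpt_castT_add_off]
  exact tendsto_minOp_rho_eps 1 Lb s hd' hs hKf0 (fun s' hs' t y => hKf' s' hs' _ y) (fun t => reDelK_transpose Lb (cubic (d + 1) (s t)) n hn a ha)
    (fun t => dotProduct_reDelK_nonneg Lb (cubic (d + 1) (s t)) n hn a ha) ha' hh₀0 hδH0
    (inv_pos.mpr (lt_of_lt_of_le (div_pos four_pos hγ₀) (le_max_left _ _))) hHent
    (fun t => coercive_reg_DelK_axial_of_ub Lb (cubic (d + 1) (s t)) n hn a ha hd2 hh0 (hHub t) ha') hHlim f g z z'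

/-! ## §3 Fine integer bonds and the named limit kernel of `𝒢_n` -/

/-- **`exists_tendsto_flucCov_DelK_axial_castT` — EL₂ OF `𝒢_n` AT FINE INTEGER BONDS**: for all `w, w′ ∈ ℤ^{d+1}` and directions `μ, μ′`, `∃ c, 𝒢_{n,t}((ŵ,μ),(ŵ′,μ′)) → c` along every cubic coarse
volume sequence (PART 190 at the block-fibred reading of `ŵ`). [folklore] -/
theorem exists_tendsto_flucCov_DelK_axial_castT (hd : 1 ≤ d) (hs : Tendsto s atTop atTop) {a' : ℝ} (ha' : 0 < a')
    (w : Fin (d + 1) → ℤ) (μ : Fin (d + 1)) (w' : Fin (d + 1) → ℤ) (μ' : Fin (d + 1)) :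
    ∃ c : ℝ, Tendsto (fun t => flucCov (reM (DelK n hn (fine (Lb * 1) (cubic (d + 1) (s t))) a ha)) (Matrix.fromRows (reM (QB 1 Lb (cubic (d + 1) (s t)))) (fun (t' : {x : Tor (fine (Lb * 1) (cubic (d + 1) (s t))) × Fin (d + 1) // (∀ ν, ν < x.2 → ((rem 1 Lb (cubic (d + 1) (s t)) x.1 ν : ℕ)) = 0) ∧ ((rem 1 Lb (cubic (d + 1) (s t)) x.1 x.2 : ℕ)) + 1 < Lb}) (x : Tor (fine (Lb * 1) (cubic (d + 1) (s t))) × Fin (d + 1)) => if x = (Function.Embedding.subtype (fun x : Tor (fine (Lb * 1) (cubic (d + 1) (s t))) × Fin (d + 1) => (∀ ν, ν < x.2 → ((rem 1 Lb (cubic (d + 1) (s t)) x.1 ν : ℕ)) = 0) ∧ ((rem 1 Lb (cubic (d + 1) (s t)) x.1 x.2 : ℕ)) + 1 < Lb)) t' then (1 : ℝ) else 0)) ((castT (fine (Lb * 1) (cubic (d + 1) (s t))) w, μ) : Tor (fine (Lb * 1) (cubic (d + 1) (s t))) × Fin (d + 1)) ((castT (fine (Lb * 1) (cubic (d + 1)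 (s t))) w', μ') : Tor (fine (Lb * 1) (cubic (d + 1) (s t))) × Fin (d + 1))) atTop (𝓝 c) := by
  have hL : (0 : ℤ) < Lb := by exact_mod_cast Nat.pos_of_ne_zero (NeZero.ne Lb)
  obtain ⟨c, hc⟩ := exists_tendsto_flucCov_DelK_axial Lb n hn a ha s hd hs ha'
    ((fun ν => (⟨(w ν % (Lb : ℤ)).toNat, by have h1 := Int.emod_lt_of_pos (w ν) hL; have h0 := Int.emod_nonneg (w ν) hL.ne'; omega⟩ : Fin Lb)), μ)
    ((fun ν => (⟨(w' ν % (Lb : ℤ)).toNat, by have h1 := Int.emod_lt_of_pos (w' ν) hL; have h0 := Int.emod_nonneg (w' ν) hL.ne'; omega⟩ : Fin Lb)), μ')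
    (fun ν => w ν / (Lb : ℤ)) (fun ν => w' ν / (Lb : ℤ))
  refine ⟨c, hc.congr fun t => ?_⟩
  rw [← castT_fine_eq_rho Lb (cubic (d + 1) (s t)) w, ← castT_fine_eq_rho Lb (cubic (d + 1) (s t)) w']

/-- **`exists_flucCov_DelK_axial_limitKernel` — THE INFINITE-VOLUME LIMIT KERNEL OF THE GAUGE-FIXED ONE-LOOP LETTER, NAMED**: in dimension `d + 1 ≥ 2`, for every `Lb ≥ 1`, all `a, a′ > 0`, every
`n ≥ 1` and every cubic coarse volume sequence `s t → ∞` there is `𝒢_∞ : (ℤ^{d+1} × Fin (d+1)) → (ℤ^{d+1} × Fin (d+1)) → ℝ` with `𝒢_{n,t}((ŵ,μ),(ŵ′,μ′)) → 𝒢_∞ (w,μ) (w′,μ′)` for ALL fine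
integer bonds — the `T ↗ ℤ^{d+1}` limit of [Balaban1987RG1] p. 264 for an2's `flucCov` of the STACKED one-step constraint (Bałaban's `C(C*Δ_kC)⁻¹C*` of (2.156)), NO RESIDUAL HYPOTHESIS. [folklore] -/
theorem exists_flucCov_DelK_axial_limitKernel (hd : 1 ≤ d) (hs : Tendsto s atTop atTop) {a' : ℝ} (ha' : 0 < a') :
    ∃ Ginf : ((Fin (d + 1) → ℤ) × Fin (d + 1)) → ((Fin (d + 1) → ℤ) × Fin (d + 1)) → ℝ,
      ∀ (w : Fin (d + 1) → ℤ) (μ : Fin (d + 1)) (w' : Fin (d + 1) → ℤ) (μ' : Fin (d + 1)),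
        Tendsto (fun t => flucCov (reM (DelK n hn (fine (Lb * 1) (cubic (d + 1) (s t))) a ha)) (Matrix.fromRows (reM (QB 1 Lb (cubic (d + 1) (s t)))) (fun (t' : {x : Tor (fine (Lb * 1) (cubic (d + 1) (s t))) × Fin (d + 1) // (∀ ν, ν < x.2 → ((rem 1 Lb (cubic (d + 1) (s t)) x.1 ν : ℕ)) = 0) ∧ ((rem 1 Lb (cubic (d + 1) (s t)) x.1 x.2 : ℕ)) + 1 < Lb}) (x : Tor (fine (Lb * 1) (cubic (d + 1) (s t))) × Fin (d + 1)) => if x = (Function.Embedding.subtype (fun x : Tor (fine (Lb * 1) (cubic (d + 1) (s t))) × Fin (d + 1) => (∀ ν, ν < x.2 → ((rem 1 Lb (cubic (d + 1) (s t)) x.1 ν : ℕ)) = 0) ∧ ((rem 1 Lb (cubic (d + 1) (s t)) x.1 x.2 : ℕ)) + 1 < Lb)) t' then (1 : ℝ) else 0)) ((castT (fine (Lb * 1) (cubic (d + 1) (s t))) w, μ) : Tor (fine (Lb * 1) (cubic (d + 1) (s t))) × Fin (d + 1)) ((castT (fine (Lb * 1) (cubic (d + 1) (s t))) w', μ') :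 Tor (fine (Lb * 1) (cubic (d + 1) (s t))) × Fin (d + 1))) atTop (𝓝 (Ginf (w, μ) (w', μ'))) := by
  have h := fun (p q : (Fin (d + 1) → ℤ) × Fin (d + 1)) => exists_tendsto_flucCov_DelK_axial_castT Lb n hn a ha s hd hs ha' p.1 p.2 q.1 q.2
  choose G hG using h
  exact ⟨G, fun w μ w' μ' => hG (w, μ) (w', μ')⟩

end Summit.QuantumFields.BalabanUV.Beta.GAN24.OneStepConstraintAxialDelKVolumeEnds

end
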